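import Mathlib.Algebra.MvPolynomial.Eval
import Mathlib.Data.Fin.Tuple.Basic
import Literature.ModelTheory.PseudofiniteFields.DefinablePredicates
import HarnessLib

/-!
# Definable subsets of `K^m` with parameters: a toolkit of closure properties

Topic `Literature/ModelTheory/PseudofiniteFields`.  Companion of `DefinablePredicates.lean`
(closure properties of "one ring formula, uniformly in the field").  Here the field `K` (in
`Type`, with a compatible ring structure) is FIXED and we look at subsets of `K^m` presented as
```
  {x : Fin m → K | φ.Realize (Sum.elim x y)}
```
for a formula `φ` of the language of rings with set variables `Fin m` and parameter variables
`Fin n`, and a tuple of parameters `y : Fin n → K` — the definable (with parameters) subsets of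
`K^m` of [ChatzidakisVanDenDriesMacintyre1992, §2–§3], in the explicit presentation used by the
counting / dimension arguments of this directory (`defSet` of `CountingDimensionDefinable.lean`
is this set, by definition).  We keep the presentation EXPLICIT (no new definition): every
statement produces `∃ n φ y, S = {x | φ.Realize (Sum.elim x y)}`.

* `exists_fin_params_eq_setOf_realize` — parameters indexed by any finite type can be
  re-indexed by `Fin n` (relabelling along `Fintype.equivFin`);
* `definableSet_inter` — intersections (conjunction, concatenating the parameter tuples);
* `exists_term_realize_eq_eval`, `definableSet_eval_eq_zero`, `definableSet_eval_ne_zero` — a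
  polynomial with coefficients in `K` is a ring term with the coefficients as parameters, so its
  zero set and its non-vanishing set are definable;
* `definableSet_preimage_subst` — pull-back along a substitution of coordinates / constants
  `x' ↦ (i ↦ Sum.elim x' c (f i))` (the constants `c` become parameters);
* `definableSet_exists_snoc` — projection along the last coordinate,
  `{x' | ∃ t, Fin.snoc x' t ∈ X}` (one existential quantifier, `Formula.iExs`).

All proofs are relabellings of variables (`Formula.relabel`) plus the realisation lemmas of
Mathlib; no property of `K` beyond being a field is used.

## References

* [ChatzidakisVanDenDriesMacintyre1992] Z. Chatzidakis, L. van den Dries, A. Macintyre, Definable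
  sets over finite fields, J. reine angew. Math. 427 (1992) 107–135, §2 (definable sets with
  parameters, "by pure logic").

## Not here

Finite unions and complements (immediate from `definable_or` / `definable_not` in the same
way), images under coordinate projections other than the last coordinate (reduce to
`definableSet_exists_snoc` with `definableSet_preimage_subst`), quantifier elimination.
-/

namespace Literature.ModelTheory.PseudofiniteFields

open FirstOrder FirstOrder.Language FirstOrder.Ring

section DefinableSets

variable {K : Type} [Field K] [CompatibleRing K]

/-- **Re-indexing the parameters by `Fin n`.**  A subset of `K^m` defined by a ring formula with
parameters indexed by a finite type `γ` is defined by a ring formula with parameters indexed by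
`Fin n` (relabel along an enumeration `γ ≃ Fin n`). [folklore] -/
theorem exists_fin_params_eq_setOf_realize {m : ℕ} {γ : Type} [Finite γ]
    (φ : Language.ring.Formula (Fin m ⊕ γ)) (v : γ → K) :
    ∃ (n : ℕ) (ψ : Language.ring.Formula (Fin m ⊕ Fin n)) (y : Fin n → K),
      {x | φ.Realize (Sum.elim x v)} = {x | ψ.Realize (Sum.elim x y)} := by
  obtain ⟨n, ⟨e⟩⟩ := Finite.exists_equiv_fin γ
  refine ⟨n, φ.relabel (Sum.map id e), v ∘ e.symm, Set.ext fun x => ?_⟩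
  simp only [Set.mem_setOf_eq, Formula.realize_relabel]
  refine iff_of_eq (congrArg _ (funext fun i => ?_))
  cases i <;> simp

/-- **Intersections of definable sets are definable**: the conjunction of the two formulas, with
the two parameter tuples side by side. [folklore] -/
theorem definableSet_inter {m : ℕ} {X Y : Set (Fin m → K)}
    (hX : ∃ (n : ℕ) (φ : Language.ring.Formula (Fin m ⊕ Fin n)) (y : Fin n → K),
      X = {x | φ.Realize (Sum.elim x y)})
    (hY : ∃ (n : ℕ) (φ : Language.ring.Formula (Fin m ⊕ Fin n)) (y : Fin n → K),
      Y = {x | φ.Realize (Sum.elim x y)}) :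
    ∃ (n : ℕ) (φ : Language.ring.Formula (Fin m ⊕ Fin n)) (y : Fin n → K),
      X ∩ Y = {x | φ.Realize (Sum.elim x y)} := by
  obtain ⟨n₁, φ₁, y₁, rfl⟩ := hX
  obtain ⟨n₂, φ₂, y₂, rfl⟩ := hY
  obtain ⟨θ, hθ⟩ := definable_and
    (definable_realize₂ φ₁ (Sum.inl : Fin m → Fin m ⊕ (Fin n₁ ⊕ Fin n₂))
      fun j => Sum.inr (Sum.inl j))
    (definable_realize₂ φ₂ (Sum.inl : Fin m → Fin m ⊕ (Fin n₁ ⊕ Fin n₂))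
      fun j => Sum.inr (Sum.inr j))
  obtain ⟨n, ψ, y, h⟩ := exists_fin_params_eq_setOf_realize θ (Sum.elim y₁ y₂)
  refine ⟨n, ψ, y, ?_⟩
  rw [← h]
  ext x
  simp only [Set.mem_inter_iff, Set.mem_setOf_eq, hθ, Sum.elim_inl, Sum.elim_inr]

/-- **A polynomial with coefficients in `K` is a ring term with the coefficients as
parameters**: for `P ∈ K[X_0, …, X_{m-1}]` there are a ring term `t(x, y)` and parameters
`y ∈ K^n` (the coefficients of `P`, indexed by an enumeration of its support) with
`t(x, y) = P(x)` for all `x ∈ K^m`. [folklore] -/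
theorem exists_term_realize_eq_eval {m : ℕ} (P : MvPolynomial (Fin m) K) :
    ∃ (n : ℕ) (t : Language.ring.Term (Fin m ⊕ Fin n)) (y : Fin n → K),
      ∀ x : Fin m → K, t.realize (Sum.elim x y) = MvPolynomial.eval x P := by
  obtain ⟨n, ⟨e⟩⟩ := Finite.exists_equiv_fin (↥P.support)
  choose pw hpw using fun (d : ↥P.support) (l : Fin m) =>
    exists_term_realize_pow (Term.var (Sum.inl l) : Language.ring.Term (Fin m ⊕ Fin n)) (d.1 l)
  choose pr hpr using fun d : ↥P.support => exists_term_realize_prod (pw d)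
  obtain ⟨t, ht⟩ := exists_term_realize_sum fun d : ↥P.support => Term.var (Sum.inr (e d)) * pr d
  refine ⟨n, t, fun j => P.coeff (e.symm j).1, fun x => ?_⟩
  rw [ht, MvPolynomial.eval_eq',
    ← Finset.sum_coe_sort P.support fun d => P.coeff d * ∏ i, x i ^ (d i)]
  refine Finset.sum_congr rfl fun d _ => ?_
  rw [realize_mul, Term.realize_var, hpr, Sum.elim_inr, Equiv.symm_apply_apply]
  refine congrArg _ (Finset.prod_congr rfl fun l _ => ?_)
  rw [hpw, Term.realize_var, Sum.elim_inl]

/-- **Zero sets of polynomials are definable**: `{x ∈ K^m | P(x) = 0}` is defined by the atomic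
formula `t(x, y) = 0` with the coefficients of `P` as parameters. [folklore] -/
theorem definableSet_eval_eq_zero {m : ℕ} (P : MvPolynomial (Fin m) K) :
    ∃ (n : ℕ) (φ : Language.ring.Formula (Fin m ⊕ Fin n)) (y : Fin n → K),
      {x | MvPolynomial.eval x P = 0} = {x | φ.Realize (Sum.elim x y)} := by
  obtain ⟨n, t, y, ht⟩ := exists_term_realize_eq_eval P
  exact ⟨n, Term.equal t 0, y, Set.ext fun x => by
    simp only [Set.mem_setOf_eq, Formula.realize_equal, ht, realize_zero]⟩

/-- **Non-vanishing sets of polynomials are definable**: `{x ∈ K^m | P(x) ≠ 0}` is defined by the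
negated atomic formula `¬ t(x, y) = 0` with the coefficients of `P` as parameters. [folklore] -/
theorem definableSet_eval_ne_zero {m : ℕ} (P : MvPolynomial (Fin m) K) :
    ∃ (n : ℕ) (φ : Language.ring.Formula (Fin m ⊕ Fin n)) (y : Fin n → K),
      {x | MvPolynomial.eval x P ≠ 0} = {x | φ.Realize (Sum.elim x y)} := by
  obtain ⟨n, t, y, ht⟩ := exists_term_realize_eq_eval P
  exact ⟨n, (Term.equal t 0).not, y, Set.ext fun x => by
    simp only [Set.mem_setOf_eq, Formula.realize_not, Formula.realize_equal, ht, realize_zero]⟩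

/-- **Pull-back along a substitution of coordinates and constants.**  For a map
`f : Fin m → Fin m' ⊕ Fin p` and constants `c ∈ K^p`, the preimage of a definable set
`X ⊆ K^m` under `K^{m'} → K^m`, `x' ↦ (i ↦ Sum.elim x' c (f i))` (each coordinate is a coordinate
of `x'` or a constant) is definable: relabel the set variable `i` to `f i`, the constants becoming
extra parameters. [folklore] -/
theorem definableSet_preimage_subst {m m' p : ℕ} (f : Fin m → Fin m' ⊕ Fin p) (c : Fin p → K)
    {X : Set (Fin m → K)}
    (hX : ∃ (n : ℕ) (φ : Language.ring.Formula (Fin m ⊕ Fin n)) (y : Fin n → K),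
      X = {x | φ.Realize (Sum.elim x y)}) :
    ∃ (n : ℕ) (φ : Language.ring.Formula (Fin m' ⊕ Fin n)) (y : Fin n → K),
      {x' : Fin m' → K | (fun i => Sum.elim x' c (f i)) ∈ X} =
        {x | φ.Realize (Sum.elim x y)} := by
  obtain ⟨n, φ, y, rfl⟩ := hX
  obtain ⟨n', ψ, y', h⟩ := exists_fin_params_eq_setOf_realize
    (φ.relabel (Sum.elim (fun i => Sum.elim Sum.inl (fun k => Sum.inr (Sum.inl k)) (f i))
      fun j => Sum.inr (Sum.inr j)) : Language.ring.Formula (Fin m' ⊕ (Fin p ⊕ Fin n)))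
    (Sum.elim c y)
  refine ⟨n', ψ, y', ?_⟩
  rw [← h]
  ext x'
  simp only [Set.mem_setOf_eq, Formula.realize_relabel]
  refine iff_of_eq (congrArg _ (funext fun v => ?_))
  rcases v with i | j
  · simp only [Sum.elim_inl, Function.comp_apply]
    cases f i <;> simp
  · simp

/-- **Projection along the last coordinate.**  For a definable set `X ⊆ K^{m+1}`, the set
`{x' ∈ K^m | ∃ t, (x', t) ∈ X}` is definable: move the last set variable to a bound variable
and quantify it existentially (`Formula.iExs` over `Unit`), keeping the parameters. [folklore] -/
theorem definableSet_exists_snoc {m : ℕ} {X : Set (Fin (m + 1) → K)}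
    (hX : ∃ (n : ℕ) (φ : Language.ring.Formula (Fin (m + 1) ⊕ Fin n)) (y : Fin n → K),
      X = {x | φ.Realize (Sum.elim x y)}) :
    ∃ (n : ℕ) (φ : Language.ring.Formula (Fin m ⊕ Fin n)) (y : Fin n → K),
      {x' : Fin m → K | ∃ t : K, Fin.snoc x' t ∈ X} = {x | φ.Realize (Sum.elim x y)} := by
  obtain ⟨n, φ, y, rfl⟩ := hX
  refine ⟨n, (φ.relabel (Sum.elim (Fin.lastCases (Sum.inr ()) fun i => Sum.inl (Sum.inl i))
      fun j => Sum.inl (Sum.inr j)) : Language.ring.Formula ((Fin m ⊕ Fin n) ⊕ Unit)).iExs Unit,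
    y, Set.ext fun x' => ?_⟩
  have key : ∀ w : Unit → K,
      (Sum.elim (Sum.elim x' y) w ∘ Sum.elim (Fin.lastCases (Sum.inr ()) fun i => Sum.inl (Sum.inl i))
        fun j => Sum.inl (Sum.inr j) : Fin (m + 1) ⊕ Fin n → K) =
        Sum.elim (Fin.snoc x' (w ()) : Fin (m + 1) → K) y := by
    intro w
    funext v
    rcases v with k | j
    · refine Fin.lastCases ?_ (fun i => ?_) k
      · simp
      · simp
    · simp
  simp only [Set.mem_setOf_eq, Formula.realize_iExs, Formula.realize_relabel, key]
  exact ⟨fun ⟨t, ht⟩ => ⟨fun _ => t, ht⟩, fun ⟨w, hw⟩ => ⟨w (), hw⟩⟩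

end DefinableSets

end Literature.ModelTheory.PseudofiniteFields
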